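import Mathlib
import Literature.NumberTheory.LFunctions.WeilMarkovQuadratic
import Literature.Analysis.SpecialFunctions.LogPiBounds
import Literature.Analysis.SpecialFunctions.EulerMascheroniBounds
import Summits.RiemannHypothesis.RiemannHypothesis.Theorems.WeilGroundStateArchimedeanWindowSimpleEvenTrial4
import HarnessLib

/-!
# The killing constant of the archimedean window: `5.3716 ≤ M_{(log 2)/2}`

Stub `stub_markovConstant_ge` (MK) for the line *parity–multiplicity–commutator* of the crux
`GroundStateSimpleEven` (Weil ground state).  The killing constant of the window `[-a, a]`,
`a = (log 2)/2`, is `M = 2∫₀^∞ (e^{t/2} − 1)/(2 sinh t) dt + log 4π + γ` (no prime power enters the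
window, `WeilGroundState.vonMangoldt_eq_zero_of_mem_weilPrimeIndex_log_two_half`); its value is
`π/2 + 3 log 2 + log π + γ = 5.37218…`.  The tree's `WeilGroundState.weilMarkovConstant_log_two_half_ge`
(`…ArchimedeanWindowSimpleEvenTrial4.lean`) gives `5.367 ≤ M` from `64` terms of the expansion
`(e^{t/2} − 1)/(2 sinh t) = Σ_k (e^{-(2k+1/2)t} − e^{-(2k+1)t})` (`t > 0`) and `log π > 1.1436`.

Here we keep the geometric tail of the expansion: after `K` terms the remainder is exactly
`e^{-(2K+1)t} (e^{t/2} − 1)/(1 − e^{-2t}) ≥ e^{-(2K+1)t}/4` (by `e^{t/2} − 1 ≥ t/2 ≥ (1 − e^{-2t})/4`),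
whose integral is `1/(4(2K+1))` (`mk_series_add_tail_le_integral_weilKillingDensity`); with `K = 64`
this gives `∫ ≥ 1.13195` (true value `π/4 + (log 2)/2 = 1.1319717…`), and with the tree's
`log π > 1.14472988…` (`LogPiBounds.lean`), `γ > 0.57721558` (`EulerMascheroniBounds.lean`) and
Mathlib's `log 2 > 0.6931471803` we get `M ≥ 5.37213 ≥ 5.3716`.
-/

open Set MeasureTheory Filter Complex

open scoped Real Topology ComplexConjugate

open Literature.NumberTheory.LFunctions

namespace Summit.RiemannHypothesis.RiemannHypothesis.Theorems.GroundStateSimpleEven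

set_option linter.dupNamespace false in
/-- The killing density dominates the partial sums of its geometric expansion **plus a quarter of
the next exponential**: for `t > 0`,
`Σ_{k<K} (e^{-(2k+1/2)t} − e^{-(2k+1)t}) + e^{-(2K+1)t}/4 ≤ (e^{t/2} − 1)/(2 sinh t)`
(the remainder of the expansion is `e^{-(2K+1)t}(e^{t/2} − 1)/(1 − e^{-2t})` and
`e^{t/2} − 1 ≥ t/2 ≥ (1 − e^{-2t})/4`). [folklore] -/
theorem mk_partial_sum_add_tail_le_weilKillingDensity {t : ℝ} (ht : 0 < t) (K : ℕ) :
    ∑ k ∈ Finset.range K,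
        (Real.exp (-(2 * (k : ℝ) + 1 / 2) * t) - Real.exp (-(2 * (k : ℝ) + 1) * t)) +
      1 / 4 * Real.exp (-(2 * (K : ℝ) + 1) * t) ≤
    (Real.exp (t / 2) - 1) / (2 * Real.sinh t) := by
  -- adapted from `WeilGroundState.partial_sum_le_weilKillingDensity` (…SimpleEvenTrial4.lean)
  set q : ℝ := Real.exp (-(2 * t)) with hq
  have hq0 : 0 < q := Real.exp_pos _
  have hq1 : q < 1 := Real.exp_lt_one_iff.2 (by linarith)
  have h1q : 0 < 1 - q := by linarith
  have h1 : 2 * Real.sinh t = (1 - q) * Real.exp t := by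
    rw [hq, Real.sinh_eq, sub_mul, ← Real.exp_add]; ring_nf
  have h2 : Real.exp (t / 2) - 1 = (Real.exp (-(t / 2)) - Real.exp (-t)) * Real.exp t := by
    rw [sub_mul, ← Real.exp_add, ← Real.exp_add, neg_add_cancel, Real.exp_zero]; ring_nf
  rw [h1, h2, mul_div_mul_right _ _ (Real.exp_pos t).ne']
  have hterm : ∀ k ∈ Finset.range K,
      Real.exp (-(2 * (k : ℝ) + 1 / 2) * t) - Real.exp (-(2 * (k : ℝ) + 1) * t) =
        (Real.exp (-(t / 2)) - Real.exp (-t)) * q ^ k := by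
    intro k _
    rw [hq, ← Real.exp_nat_mul, sub_mul, ← Real.exp_add, ← Real.exp_add]
    congr 2 <;> ring
  have htail : Real.exp (-(2 * (K : ℝ) + 1) * t) = Real.exp (-t) * q ^ K := by
    rw [hq, ← Real.exp_nat_mul, ← Real.exp_add]
    congr 1; ring
  rw [Finset.sum_congr rfl hterm, ← Finset.mul_sum, htail, le_div_iff₀ h1q]
  -- `Σ_{k<K} q^k (1 − q) = 1 − q^K`
  have hSA : (Real.exp (-(t / 2)) - Real.exp (-t)) * (∑ k ∈ Finset.range K, q ^ k) * (1 - q) =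
      (Real.exp (-(t / 2)) - Real.exp (-t)) * (1 - q ^ K) := by
    rw [mul_assoc, geom_sum_mul_neg]
  -- the key pointwise inequality `e^{-t}(1 − q)/4 ≤ e^{-t/2} − e^{-t}`
  have h3 : t / 2 ≤ Real.exp (t / 2) - 1 := by linarith [Real.add_one_le_exp (t / 2)]
  have h4 : 1 - q ≤ 2 * t := by
    have := Real.add_one_le_exp (-(2 * t)); rw [← hq] at this; linarith
  have hkey : 1 / 4 * Real.exp (-t) * (1 - q) ≤ Real.exp (-(t / 2)) - Real.exp (-t) := by
    have hE : Real.exp (-(t / 2)) - Real.exp (-t) = Real.exp (-t) * (Real.exp (t / 2) - 1) := by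
      rw [mul_sub, ← Real.exp_add, mul_one, show -t + t / 2 = -(t / 2) by ring]
    rw [hE]
    calc 1 / 4 * Real.exp (-t) * (1 - q) ≤ 1 / 4 * Real.exp (-t) * (2 * t) := by gcongr
      _ = Real.exp (-t) * (t / 2) := by ring
      _ ≤ Real.exp (-t) * (Real.exp (t / 2) - 1) := by gcongr
  have hprod := mul_le_mul_of_nonneg_right hkey (pow_nonneg hq0.le K)
  linarith

set_option linter.dupNamespace false in
/-- **The killing integral dominates its series with the geometric tail**: for every `K`,
`Σ_{k<K} (1/(2k+1/2) − 1/(2k+1)) + 1/(4(2K+1)) ≤ ∫₀^∞ (e^{t/2} − 1)/(2 sinh t) dt`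
(integrate `mk_partial_sum_add_tail_le_weilKillingDensity` term by term). [folklore] -/
theorem mk_series_add_tail_le_integral_weilKillingDensity (K : ℕ) :
    ∑ k ∈ Finset.range K, (1 / (2 * (k : ℝ) + 1 / 2) - 1 / (2 * (k : ℝ) + 1)) +
        1 / (4 * (2 * (K : ℝ) + 1)) ≤
      ∫ t in Ioi (0 : ℝ), (Real.exp (t / 2) - 1) / (2 * Real.sinh t) := by
  -- adapted from `WeilGroundState.integral_weilKillingDensity_ge` (…SimpleEvenTrial4.lean)
  set F : ℝ → ℝ := fun t ↦ ∑ k ∈ Finset.range K,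
    (Real.exp (-(2 * (k : ℝ) + 1 / 2) * t) - Real.exp (-(2 * (k : ℝ) + 1) * t)) +
      1 / 4 * Real.exp (-(2 * (K : ℝ) + 1) * t) with hF
  have ha : ∀ k : ℕ, -(2 * (k : ℝ) + 1 / 2) < 0 := fun k ↦ by
    have : (0 : ℝ) ≤ k := Nat.cast_nonneg k; linarith
  have hb : ∀ k : ℕ, -(2 * (k : ℝ) + 1) < 0 := fun k ↦ by
    have : (0 : ℝ) ≤ k := Nat.cast_nonneg k; linarith
  have hik : ∀ k : ℕ, IntegrableOn (fun t ↦ Real.exp (-(2 * (k : ℝ) + 1 / 2) * t) -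
      Real.exp (-(2 * (k : ℝ) + 1) * t)) (Ioi 0) :=
    fun k ↦ (integrableOn_exp_mul_Ioi (ha k) _).sub (integrableOn_exp_mul_Ioi (hb k) _)
  have hSi : IntegrableOn (fun t ↦ ∑ k ∈ Finset.range K,
      (Real.exp (-(2 * (k : ℝ) + 1 / 2) * t) - Real.exp (-(2 * (k : ℝ) + 1) * t))) (Ioi 0) :=
    integrable_finsetSum _ fun k _ ↦ hik k
  have hiK : IntegrableOn (fun t ↦ 1 / 4 * Real.exp (-(2 * (K : ℝ) + 1) * t)) (Ioi 0) :=
    (integrableOn_exp_mul_Ioi (hb K) _).const_mul _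
  have hFi : IntegrableOn F (Ioi 0) := by rw [hF]; exact hSi.add hiK
  have hFint : ∫ t in Ioi (0 : ℝ), F t =
      ∑ k ∈ Finset.range K, (1 / (2 * (k : ℝ) + 1 / 2) - 1 / (2 * (k : ℝ) + 1)) +
        1 / (4 * (2 * (K : ℝ) + 1)) := by
    rw [hF]
    simp only
    rw [integral_add hSi hiK, integral_finsetSum _ fun k _ ↦ hik k, integral_const_mul,
      integral_exp_mul_Ioi (hb K)]
    congr 1
    · refine Finset.sum_congr rfl fun k _ ↦ ?_
      rw [integral_sub (integrableOn_exp_mul_Ioi (ha k) _) (integrableOn_exp_mul_Ioi (hb k) _),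
        integral_exp_mul_Ioi (ha k), integral_exp_mul_Ioi (hb k)]
      simp only [mul_zero, Real.exp_zero]
      have h1 : (2 * (k : ℝ) + 1 / 2) ≠ 0 := by positivity
      have h2 : (2 * (k : ℝ) + 1) ≠ 0 := by positivity
      field_simp
    · simp only [mul_zero, Real.exp_zero]
      have h2 : (2 * (K : ℝ) + 1) ≠ 0 := by positivity
      field_simp
  calc _ = ∫ t in Ioi (0 : ℝ), F t := hFint.symm
    _ ≤ ∫ t in Ioi (0 : ℝ), (Real.exp (t / 2) - 1) / (2 * Real.sinh t) :=
        setIntegral_mono_on hFi integrableOn_weilKillingDensity measurableSet_Ioi fun t ht ↦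
          mk_partial_sum_add_tail_le_weilKillingDensity ht K

set_option linter.dupNamespace false in
/-- **The killing integral to five digits**: `1.13195 ≤ ∫₀^∞ (e^{t/2} − 1)/(2 sinh t) dt`
(`= π/4 + (log 2)/2 = 1.1319717…`; `64` terms of `Σ (1/(2k+1/2) − 1/(2k+1))` and the geometric
tail `1/516`, `mk_series_add_tail_le_integral_weilKillingDensity`). [folklore] -/
theorem mk_integral_weilKillingDensity_ge :
    (1.13195 : ℝ) ≤ ∫ t in Ioi (0 : ℝ), (Real.exp (t / 2) - 1) / (2 * Real.sinh t) := by
  refine le_trans ?_ (mk_series_add_tail_le_integral_weilKillingDensity 64)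
  simp only [Finset.sum_range_succ, Finset.sum_range_zero]
  norm_num

end Summit.RiemannHypothesis.RiemannHypothesis.Theorems.GroundStateSimpleEven

namespace Summit.RiemannHypothesis.RiemannHypothesis.Theorems

set_option linter.dupNamespace false in
/-- **The killing constant of the archimedean window: `5.3716 ≤ M_{(log 2)/2}`**
(`M = π/2 + 3 log 2 + log π + γ = 5.37218…`; no prime power enters the window, the killing
integral is `≥ 1.13195` by `GroundStateSimpleEven.mk_integral_weilKillingDensity_ge`, and
`log 4π + γ = 2 log 2 + log π + γ` with `log 2 > 0.6931471803`, `log π > 1.14472988…`,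
`γ > 0.57721558`). [folklore] -/
theorem stub_markovConstant_ge :
    (5.3716 : ℝ) ≤ weilMarkovConstant (Real.log 2 / 2) := by
  unfold weilMarkovConstant
  rw [Finset.sum_eq_zero fun n hn ↦ by
    rw [WeilGroundState.vonMangoldt_eq_zero_of_mem_weilPrimeIndex_log_two_half hn]; simp]
  have h1 := GroundStateSimpleEven.mk_integral_weilKillingDensity_ge
  have h2 : Real.log (4 * π) = 2 * Real.log 2 + Real.log π := by
    rw [Real.log_mul (by norm_num) Real.pi_pos.ne', show (4 : ℝ) = 2 ^ 2 by norm_num, Real.log_pow]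
    push_cast; ring
  have h3 := Literature.Analysis.SpecialFunctions.Real.log_pi_gt_d20
  have h4 := Real.log_two_gt_d9
  have h5 := Literature.Analysis.SpecialFunctions.Real.eulerMascheroniConstant_gt_d8
  rw [h2]
  linarith

end Summit.RiemannHypothesis.RiemannHypothesis.Theorems
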